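import Mathlib
import Literature.MathematicalPhysics.QuantumFieldTheory.Balaban1983to89.B7Eq61Linearization
import Literature.MathematicalPhysics.QuantumFieldTheory.Balaban1983to89.B13CorridorSeparation
import Literature.MathematicalPhysics.QuantumFieldTheory.Balaban1983to89.B12Lineariz267

/-!
# `Balaban1983to89.B12HOperator267` — B12 [Balaban1987RG1] p. 267: the operator `h` («LQ̃h = I»,
# «(hB)(b₀(c)) = h(c)B(c)», «h(c) … equal to an inverse of a coefficient at the variable B′(b₀(c)) in (Q̃B′)(c),
# multiplied by L⁻¹», «Of course h is uniquely defined by these conditions») COMPUTED AND PROVED on the lattice for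
# the typed main term `Q₀` of the averaging: `h(c) = L^{d−1}·R(V₀([Lc₋, b₀(c)₋]))⁻¹`, `‖h(c)‖ = L^{d−1}`

CITATION HEADER (lean-in-tree rule 2026-08-18).  T. Bałaban, *Renormalization group approach to lattice gauge field
theories. I. Generation of effective actions in a small field approximation and a coupling constant renormalization
in four dimensions*, Commun. Math. Phys. **109** (1987) 249–301, bib key `Balaban1987RG1` ("B12" of the cell),
p. 267; renders READ AS IMAGES for this module by unit b2b-balaban-b12-g20 (pub-balaban PAPER SUB-CELL B12 gen 20,
2026-08-19): `…/1987-cmp109-rg-I-small-field-p019-x2.png` (p. 267: the `h` paragraph), `p018-x2` (p. 266: (2.4)),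
`p005-x2` (p. 253: (0.4)), `p006-x2` (p. 254: (0.12)) (PDF page = journal page − 248).  The typed averaging is the
one of B7 = T. Bałaban, *Averaging operations for lattice gauge theories*, Commun. Math. Phys. **98** (1985) 17–51,
bib key `Balaban1985Averaging`, p. 28 (render `…/1985-cmp98-averaging-p012-x2.png`, PDF = journal − 16) — the
tree's `B7Eq61Linearization.Q0` — on the corner-cube block geometry and contours of [2] = B5 = T. Bałaban,
*Propagators and renormalization transformations for lattice gauge theories. I*, Commun. Math. Phys. **95** (1984)
17–40, bib key `Balaban1984PropagatorsI`, pp. 18–19 (renders `…/1984-cmp95-propagators-rt-I-p002-x2.png`,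
`p003-x2.png`, PDF = journal − 16): (1.6), (1.7), (1.8), (1.11).  SIBLINGS, imported and used BY NAME, nothing
restated: `B7Eq61Linearization` (`pathProd`, `lineR`, `lineRA`, `Q0`, `Q0_const_one`, the `ConjAct` norm lemma
`norm_conjAct_smul_le`), `B7BlockGeometry` (`qppBonds` = the bonds `⊂ B(c₋) ∪ B(c₊)`, `line_mem_twoBlocks`, `Qav` =
[2] (1.11)), `B13CorridorSeparation` (`b0Z` = `b₀(c)` on `ℤᵈ`, the corridor separation `eq_of_b0Z_mem_qppBonds`,
`b0Z_injective`), `B13PkLocalTerms` (`hOp b₀ h` = the diagonal operator «(hB)(b₀(c)) = h(c)B(c)», `hOp_apply_b₀`,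
`hOp_eq_zero_off_range`), `B12Lineariz267` (§ 1: the algebra of `B′ = B − hD̃(B)` under the BINDER
`hLQh : ∀ X, LQ (hop X) = X`), `QuantumLattice.BalabanRG` (`blockMap`, `blockBase`, `blockSites`).

WHAT IS PRINTED (verbatim, from the renders).
* [B12] p. 267 [PDF 19]: *«At first we introduce an operator h. It transforms 𝐠-valued functions B defined at bonds
  of the lattice T⁽ᵏ⁺¹⁾ into such functions defined at bonds of T⁽ᵏ⁾. The function hB is equal to 0 everywhere,
  except the set {b₀(c) : c ∈ T⁽ᵏ⁺¹⁾}. [Let us recall that for c ∈ T⁽ᵏ⁺¹⁾ the bond b₀(c) is defined as the bond of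
  the lattice T⁽ᵏ⁾ contained in c and belonging to the corridor B(c) = {b ∈ T⁽ᵏ⁾ : b₋ ∈ B(c₋), b₊ ∈ B(c₊)}.]
  Furthermore, the operator h satisfies the identity LQ̃h = I on T⁽ᵏ⁺¹⁾. Of course h is uniquely defined by these
  conditions, in fact it is a very simple operator given by the equality (hB)(b₀(c)) = h(c)B(c), where h(c) is a
  linear operator on the Lie algebra 𝐠, equal to an inverse of a coefficient at the variable B′(b₀(c)) in (Q̃B′)(c),
  multiplied by L⁻¹.»*  (the square brackets are print's.)  p. 266 (2.4): *«The expression under the δ-function is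
  equal to M(V′V⁽ᵏ⁾)M(V⁽ᵏ⁾)⁻¹ = exp iQ̃(B′). (2.4)»*; the averages `M` are (0.4) p. 253 *«Ū(c) = M(U, c) =
  exp[i Σ_{x∈B(c₋)} L⁻ᵈ Σ_{Γ∈G(c₋,x)} |G(c₋,x)|⁻¹ Σ_{Γ′∈G(c₊,x′)} |G(c₊,x′)|⁻¹ × (1/i) log U(Γ∪[x,x′]∪(−Γ′)∪(−c))]
  U(c)»* or (0.12) p. 254 *«Ū(c) = exp[i Σ_{x∈B(c₋)} L⁻ᵈ (1/i) log U(c₋,x)U([x,x′])U(x′,c₊)U(−c)] U(c)»*, with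
  p. 254: *«This average has properties similar to the properties of the average introduced in (0.4), especially
  all results of the paper [12] are valid for it. […] Let us stress that both definitions are equally good for our
  purposes, in fact we may use many other definitions.»*
* [B7] p. 28 [PDF 12]: *«Because of the axial gauge conditions (58), the average (V′V₀)_c depends on
  (R_{0,c₋}V′)([x, x(c)]) = Π_{b⊂[x,x(c)]} R(V₀(Γ_{c₋,x}∪[x, b₋]))V′_b, x ∈ B(c₋), and a good approximation of the
  function (1/i) log(V′V₀)_c(V̄₀)_c⁻¹ for V′ = e^{iA}, A small, is given by (Q₀A)(c) = Σ_{x∈B(c₋)} L⁻ᵈ(R_{0,c₋}A)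
  ([x, x(c)]), where R_{0,c₋}A is defined as R_{0,c₋}V′, only the product over b is replaced by the sum.»*
* [2] p. 18 [PDF 2], (1.6): *«B(y) = {x ∈ T₁ : y_μ ≦ x_μ < y_μ + L, μ = 1, …, d}, y ∈ T_L⁽¹⁾.»*; (1.7): *«In each
  block B(y) we introduce a family of contours Γ_{y,x} connecting the points y and x: Γ_{y,x} = [y, (y₁, …,
  y_{d−1}, x_d)] ∪ … ∪ [(y₁, …, y_μ, x_{μ+1}, …, x_d), (y₁, …, x_μ, x_{μ+1}, …, x_d)] ∪ … ∪ [(y₁, x₂, …, x_d), x],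
  (1.7) where [x₁, x₂] is a line segment connecting points x₁, x₂.»*; p. 19 [PDF 3], (1.8): *«… x(c) denotes a
  point in the block B(c₊) obtained by translation of x by the bond c, so if c = ⟨y, y + Le_μ⟩ then x(c) = x +
  Le_μ.»*; (1.11): *«(QA)_c = Σ_{x∈B(c₋)} L^{−(d+1)} A([x, x(c)])»*.

THE TYPING (cell DIVERGENCE row D-b12g20.1, word by word).  (a) LATTICE: `ℤᵈ` (sites `Fin d → ℤ`), positively
oriented bonds `(x, μ) = ⟨x, x + e_μ⟩ : ZdEdge d`, ratio `L`, CORNER cubes `B(y) = {x : ⌊x/L⌋ = y}` = [2] (1.6)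
(`blockSites L y`; [B12] itself uses centred cubes on tori, p. 252 — as in the sibling `B13CorridorSeparation`,
D-b13.20, the combinatorics is translation-equivalent); `b₀(c)` = `b0Z L c = (L·c₋ + (L−1)e_μ, μ)`, the last bond of
the axis line of `B(c₋)` in direction `μ = c.2`, the unique bond of that line in print's corridor.  (b) THE OPERATOR
`LQ̃` IS TYPED AS THE MAIN TERM `Q₀` of [B7] p. 28 (`Q0 L T R`, weight `L⁻ᵈ`; `= L ×` [2] (1.11) at flat background,
`Q0_const_one`): transporter data `T x = R(V₀(Γ_{c₋,x}))` (site) and `R b = R(V₀(b))` (bond) valued in a monoid /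
group `G` acting on the fibre `V` (print: `G`-valued `V₀`, `R = Ad` on `𝐠`, [B7] (56)); `Q₀` is print's «good
approximation» = LINEAR PART of `(1/i) log(V′V₀)_c(V̄₀)_c⁻¹` for THE [B7] AVERAGE in the axial gauge (58).  [B12]'s
`LQ̃` is the linear part of `Q̃` in (2.4) for the averages (0.4)/(0.12), whose integration variables live on all
bonds of `T⁽ᵏ⁾` (no axial gauge inside blocks): its coefficient at `B′(b₀(c))` is the `Q₀`-coefficient computed here
PLUS background-dependent contributions of the legs `U(−c)` (inside the logarithm, one per `x`, weight `L⁻ᵈ`) against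
the outer factor `U(c)` — they cancel exactly at flat background and are NOT displayed in print; THIS FILE DOES NOT
TYPE THEM.  What it proves for [B12]'s own `LQ̃` is therefore exactly § 2 (abstract: ANY operator with the printed
locality «depends on A restricted to B(c₋) ∪ B(c₊)», [B7] Prop. 4 p. 38 as quoted in `B13CorridorSeparation`):
existence ⟺ the corridor coefficients are onto, uniqueness ⟸ they are one-to-one, and then `h` IS the diagonal
operator — i.e. «Of course h is uniquely defined» holds PRECISELY when the coefficient print inverts is invertible,
which print presupposes («an inverse of a coefficient»).  (c) CONTOURS: the only property of `Γ_{y,x}` used is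
`AxisStraight` (the contour to a site on an axis line of the block is the straight segment), PROVED for the printed
contours (1.7) (`axisStraight_gammaT`), so every hypothesis `hT` below is satisfiable for every background.
(d) NORMS: `G = ConjAct Aˣ` acting on a real normed algebra `A` by conjugation ([B7] (56) `R(X)Y = XYX⁻¹`), operator
norm; «unitary» enters as `‖U(b)‖ ≤ 1 ∧ ‖U(b)⁻¹‖ ≤ 1`.

WHAT IS PROVED (kernel; `[folklore]` = finite algebra on `ℤᵈ`, `[cite]` = a printed sentence holding as a theorem of
the typed objects; NOTHING of [B12] is assumed anywhere — zero hypotheses structures, zero cited facts).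
* §1 `pathProd_add`, `lineR_add` (concatenation of straight transporters).
* §2 ABSTRACT (any `𝒬` with `IsQppLocal L 𝒬` := «(𝒬A)(c) depends on A_b, b ⊂ B(c₋) ∪ B(c₊)»; corridor coefficient
  `bcoef L 𝒬 c v := 𝒬(δ_{b₀(c)}v)(c)`; `CorridorSupported` := «hB = 0 except on {b₀(c)}»):
  `apply_of_supported : 𝒬(𝒽B)(c) = K(c)((𝒽B)(b₀(c)))`; **`hOp_rightInverse_iff`** (`𝒬 ∘ hOp b₀ h = id ⟺ ∀ c,
  K(c) ∘ h(c) = id`); **`exists_rightInverse_iff`** (a corridor-supported right inverse exists ⟺ every `K(c)` is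
  onto); **`rightInverse_unique`** (one-to-one `K(c)` ⟹ at most one); **`eq_hOp_of_rightInverse`** («in fact it is a
  very simple operator given by the equality (hB)(b₀(c)) = h(c)B(c)» — FORCED); `bcoef_h_of_rightInverse`,
  `h_bcoef_of_rightInverse` (`h(c) = K(c)⁻¹`).
* §3 MAIN TERM: `isQppLocal_Q0` ([B7] Prop. 4's locality, here a theorem for `Q₀`); `axisSite`, `bond_eq_b0Z_iff`
  (the `l`-th bond of `[x, x(c)]` is `b₀(c)` iff `x = Lc₋ + (L−1−l)e_μ`); **`Q0_eq_coef` / `bcoef_Q0`: the corridor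
  coefficient of `Q₀` is `K(c)v = L⁻ᵈ Σ_{l<L} R(V₀(Γ_{c₋,x_l} ∪ [x_l, b₀(c)₋]))v`**; `Q0_hOp`; `coefₗ` (linear).
* §4 STRAIGHT AXIS CONTOURS (`AxisStraight L T R`): `transport_eq_gcorner`; **`coef_eq_of_axisStraight : K(c)v =
  (L⁻ᵈ·L)·g(c)v`**, `g(c) = gcorner L R c = R(V₀([Lc₋, b₀(c)₋]))` (cell GAPS G-adv9-22 (U2)'s `L⁻ᵈ·Ad` in the
  `Q̃`-normalisation); **`hMain L R c v := (Lᵈ/L)·g(c)⁻¹v`**; `coef_hMain`, `hMain_coef`, `coef_bijective`;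
  **`Q0_hOp_hMain : Q₀(hB)(c) = B(c)`** («LQ̃h = I», exact, every `B`, no smallness); `hOp_hMain_Q0` (the converse
  `h(LQ̃A) = A` on `b₀`-supported `A`, GAPS C-adv9-23 (a)); **`eq_hOp_hMain`** («Of course h is uniquely defined by
  these conditions»); `hOp_rightInverse_iff_eq_hMain`; `coefQt` (the normalised coefficient `L⁻¹K(c) = L⁻ᵈg(c)` as
  `V ≃ₗ[ℝ] V`) and **`hMain_eq_inv_coefQt : h(c) = L⁻¹ • (coefQt c)⁻¹`** (print's formula, literally);
  `pow_div_self_eq : Lᵈ/L = L^{d−1}`; `coefₗ_eq_smul_toLinearMap : K(c) = (L⁻ᵈL) • ρ(g(c))` — ITEM 7 of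
  `Beta.ConstraintElimination` («whether Bałaban's coefficient has this shape is NOT asserted here») SETTLED for the
  typed main term; `det_coefₗ`, `abs_det_coefₗ` (`|det K(c)| = (L⁻ᵈL)^{dim V}` when `|det ρ(g(c))| = 1`:
  background-free Jacobian factor).
* §4b LINEAR PACKAGING `Q0ₗ`, `hOpₗ`, `hMainₗ`; **`hLQh_main : ∀ X, Q0ₗ (hOpₗ hMainₗ X) = X`** — the binder `hLQh` of
  `B12Lineariz267` § 1 DISCHARGED — and `linearizes_main` / `constraint_eq_zero_iff_main` =
  `B12Lineariz267.linearizes` / `.constraint_eq_zero_iff` BY NAME for the explicit `h`.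
* §5 NORM: `norm_hMain_le : ‖h(c)X‖ ≤ (Lᵈ/L)‖X‖` given `‖g(c)‖, ‖g(c)⁻¹‖ ≤ 1`; `norm_hMain_le_of_bond` (from
  bondwise `‖U(b)‖, ‖U(b)⁻¹‖ ≤ 1`, `‖1‖ = 1`); `norm_hMain_eq` (`= (Lᵈ/L)‖X‖` for isometric conjugation) — the
  bound `|hB| ≤ B₀′|B|`, `B₀′ = L^{d−1}` of GAPS G-adv9-22 (U2), which print does not state.
* §6 FLAT: `hMain_const_one : h(c) = Lᵈ/L`; on the tree's real `Qav` ([2] (1.11)) **`Qav_single_b0Z : the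
  coefficient of f(b₀(c)) in (Qf)(c) is L⁻ᵈ`** and **`Qav_hOp : L·Q(hOp b₀ (L^{d−1}·) B) = B`**.
* §7 `gammaT` = `R(V₀(Γ_{y,x}))` for the contours (1.7); **`axisStraight_gammaT`**.
* §8 `h_paragraph_p267` — the five printed clauses as ONE theorem about the explicit `hOp b₀ hMain`; two `example`s
  instantiate «LQ̃h = I» and uniqueness at `d = 2`, `L = 3` with `T = gammaT 3 R`, ARBITRARY background `R`
  (non-degenerate satisfiability).

VALUE / HONEST FRAMING (cell `pub-balaban`, B12 sub-cell; verbatim in substance): a KERNEL CERTIFICATE for cell GAPS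
G-adv9-22 (U2) («B12 prints neither the coefficient nor the norm, and "Of course h is uniquely defined by these
conditions" needs exactly its invertibility») and C-adv9-23 (a), and for item 7 of `Beta.ConstraintElimination` —
for the typed main term the coefficient IS `L^{1−d}ρ(g(c))`, IS invertible, `h` IS unique and diagonal with
`h(c) = L^{d−1}ρ(g(c))⁻¹`, `‖h‖ = L^{d−1}` (`L³` at `d = 4`); for [B12]'s own `LQ̃` the file proves the
existence/uniqueness/diagonality CRITERIA of § 2 and nothing more (THE TYPING (b)).  NOT summit progress; nothing of
the series is asserted or certified beyond these lines.  ABSOLUTE RULE (cell charter): no internally-minted statement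
enters as a cited fact — every hypothesis of every theorem below is a definition unfolded or is discharged in § 7/§ 8;
the manuscript under audit is quoted, never cited as authority.
-/

noncomputable section

namespace Literature.MathematicalPhysics.QuantumFieldTheory.Balaban1983to89.B12HOperator267

open Finset
open Literature.MathematicalPhysics.QuantumLattice (ZdEdge blockMap blockBase blockSites mem_blockSites_iff
  card_blockSites blockMap_blockBase_add_of_lt)
open B7BlockGeometry (qppBonds mem_qppBonds twoBlocks line_mem_twoBlocks Qav Qav_apply)
open B7Eq61Linearization (pathProd pathProd_zero pathProd_succ pathProd_const_one lineR lineR_const_one lineRA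
  Q0 Q0_apply Q0_const_one conjAct_smul_eq norm_conjAct_smul_le)
open B13CorridorSeparation (b0Z eq_of_b0Z_mem_qppBonds b0Z_mem_qppBonds b0Z_injective)
open B13PkLocalTerms (hOp hOp_apply_b₀ hOp_eq_zero_off_range)

variable {d : ℕ}

/-! ## §1  Contour algebra: concatenation of straight transporters [folklore] -/

section Contour

variable {G : Type*} [Monoid G]

/-- [folklore] Concatenation of ordered products: transporting along `a + b` bonds is transporting along the
first `a` and then along the next `b` (B7 (9) `U(Γ) = Π U(xᵢ, xᵢ₊₁)` for `Γ = Γ₁ ∪ Γ₂`). -/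
theorem pathProd_add (g : ℕ → G) (a b : ℕ) :
    pathProd g (a + b) = pathProd g a * pathProd (fun t => g (a + t)) b := by
  induction b with
  | zero => rw [add_zero, pathProd_zero, mul_one]
  | succ b ih => rw [← add_assoc, pathProd_succ, ih, pathProd_succ, mul_assoc]

/-- [folklore] `R(V₀([x, x + (a+b)e_μ])) = R(V₀([x, x + a e_μ])) · R(V₀([x + a e_μ, x + (a+b)e_μ]))`. -/
theorem lineR_add (R : ZdEdge d → G) (x : Fin d → ℤ) (μ : Fin d) (a b : ℕ) :
    lineR R x μ (a + b) = lineR R x μ a * lineR R (x + Pi.single μ (a : ℤ)) μ b := by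
  simp only [lineR]
  rw [pathProd_add]
  congr 2
  funext t
  simp only [Nat.cast_add, Pi.single_add, add_assoc]

/-- [folklore] the empty straight contour transports by `1`. -/
@[simp] theorem lineR_zero (R : ZdEdge d → G) (x : Fin d → ℤ) (μ : Fin d) : lineR R x μ 0 = 1 :=
  pathProd_zero _

end Contour

/-! ## §2  Corridor-supported right inverses of a `B(c₋) ∪ B(c₊)`-local operator [folklore]

The abstract content of the p. 267 sentences «hB is equal to 0 everywhere, except the set {b₀(c)}»,
«LQ̃h = I», «Of course h is uniquely defined by these conditions, in fact it is a very simple operator given by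
the equality (hB)(b₀(c)) = h(c)B(c)»: for ANY operator `𝒬` on fine-bond fields whose value at the coarse bond `c`
depends only on the variables on the bonds `⊂ B(c₋) ∪ B(c₊)` (the printed locality of [B7] Prop. 4, hypothesis
shape `hCt` of `B13CorridorSeparation` §4), the corridor separation `b₀(c′) ⊂ B(c₋) ∪ B(c₊) ⇒ c′ = c`
(`B13CorridorSeparation.eq_of_b0Z_mem_qppBonds`) reduces everything to the CORRIDOR COEFFICIENTS
`K(c) v := 𝒬(δ_{b₀(c)} v)(c)`: a `b₀`-supported right inverse exists iff every `K(c)` is onto, is unique iff (given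
existence) every `K(c)` is one-to-one, and is then the diagonal operator `hOp b₀ h`, `h(c) = K(c)⁻¹`. -/

section Local

variable {V : Type*} [Zero V]

/-- [folklore] «(𝒬A)(c) depends on A_b, b ⊂ B(c₋) ∪ B(c₊)» ([B7] Prop. 4 p. 38; the `hCt` / `hN` binder of
`B13CorridorSeparation` §4 and `B13PkLocalTerms.isLocalIn_fpMap` on the `ℤᵈ` corner-cube geometry, ratio `L`). -/
def IsQppLocal (L : ℕ) (𝒬 : (ZdEdge d → V) → ZdEdge d → V) : Prop :=
  ∀ A A' c, (∀ b ∈ qppBonds L c, A b = A' b) → 𝒬 A c = 𝒬 A' c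

/-- [folklore] THE CORRIDOR COEFFICIENT of `𝒬` at `c`: «a coefficient at the variable B′(b₀(c)) in (Q̃B′)(c)» read
as the map `v ↦ 𝒬(δ_{b₀(c)}·v)(c)` (for a linear `𝒬` this is the `(c, b₀(c))` block of its matrix). -/
def bcoef (L : ℕ) (𝒬 : (ZdEdge d → V) → ZdEdge d → V) (c : ZdEdge d) (v : V) : V :=
  𝒬 (Pi.single (b0Z L c) v) c

/-- [folklore] «The function hB is equal to 0 everywhere, except the set {b₀(c) : c ∈ T⁽ᵏ⁺¹⁾}» as a predicate on an
operator `𝒽` from coarse-bond fields to fine-bond fields. -/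
def CorridorSupported (L : ℕ) (𝒽 : (ZdEdge d → V) → ZdEdge d → V) : Prop :=
  ∀ B b, (¬ ∃ c, b0Z L c = b) → 𝒽 B b = 0

/-- [folklore] the diagonal operators `hOp b₀ h` of `B13PkLocalTerms` («(hB)(b₀(c)) = h(c)B(c)», `0` elsewhere) are
corridor-supported. -/
theorem corridorSupported_hOp (L : ℕ) (h : ZdEdge d → V → V) : CorridorSupported L (hOp (b0Z (d := d) L) h) :=
  fun B _ hb => hOp_eq_zero_off_range h B hb

variable {L : ℕ} {𝒬 : (ZdEdge d → V) → ZdEdge d → V}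

/-- [folklore] A field vanishing on `B(c₋) ∪ B(c₊)` off `b₀(c)` is seen by `(𝒬 ·)(c)` only through the corridor
coefficient applied to its value at `b₀(c)`. -/
theorem IsQppLocal.apply_eq_bcoef (h𝒬 : IsQppLocal L 𝒬) {A : ZdEdge d → V} {c : ZdEdge d}
    (hA : ∀ b ∈ qppBonds L c, b ≠ b0Z L c → A b = 0) : 𝒬 A c = bcoef L 𝒬 c (A (b0Z L c)) := by
  refine h𝒬 A _ c fun b hb => ?_
  by_cases hbc : b = b0Z L c
  · rw [hbc, Pi.single_eq_same]
  · rw [hA b hb hbc, Pi.single_eq_of_ne hbc]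

/-- [folklore] **`(𝒬 𝒽B)(c) = K(c)((𝒽B)(b₀(c)))` for every corridor-supported `𝒽`** — the corridor separation
`b₀(c′) ⊂ B(c₋) ∪ B(c₊) ⇒ c′ = c` kills every other distinguished bond. -/
theorem IsQppLocal.apply_of_supported (h𝒬 : IsQppLocal L 𝒬) (hL : 0 < L) {𝒽 : (ZdEdge d → V) → ZdEdge d → V}
    (h𝒽 : CorridorSupported L 𝒽) (B : ZdEdge d → V) (c : ZdEdge d) :
    𝒬 (𝒽 B) c = bcoef L 𝒬 c (𝒽 B (b0Z L c)) :=
  h𝒬.apply_eq_bcoef fun b hb hbc => h𝒽 B b (by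
    rintro ⟨c', rfl⟩
    exact hbc (congrArg (b0Z L) (eq_of_b0Z_mem_qppBonds hL hb)))

/-- [folklore] `(𝒬 (hOp b₀ h B))(c) = K(c)(h(c)B(c))`. -/
theorem IsQppLocal.apply_hOp (h𝒬 : IsQppLocal L 𝒬) (hL : 0 < L) (h : ZdEdge d → V → V) (B : ZdEdge d → V)
    (c : ZdEdge d) : 𝒬 (hOp (b0Z L) h B) c = bcoef L 𝒬 c (h c (B c)) := by
  rw [h𝒬.apply_of_supported hL (corridorSupported_hOp L h), hOp_apply_b₀ (b0Z_injective hL)]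

/-- [folklore] **RIGHT-INVERSE CRITERION**: `𝒬 ∘ hOp b₀ h = id` («LQ̃h = I on T⁽ᵏ⁺¹⁾») iff `K(c) ∘ h(c) = id` for
every coarse bond `c`. -/
theorem IsQppLocal.hOp_rightInverse_iff (h𝒬 : IsQppLocal L 𝒬) (hL : 0 < L) (h : ZdEdge d → V → V) :
    (∀ B c, 𝒬 (hOp (b0Z L) h B) c = B c) ↔ ∀ c v, bcoef L 𝒬 c (h c v) = v := by
  constructor
  · intro H c v
    have := H (fun _ => v) c
    rwa [h𝒬.apply_hOp hL] at this
  · intro H B c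
    rw [h𝒬.apply_hOp hL, H]

/-- [folklore] **EXISTENCE**: a corridor-supported right inverse of `𝒬` exists iff every corridor coefficient
`K(c)` is ONTO. -/
theorem IsQppLocal.exists_rightInverse_iff (h𝒬 : IsQppLocal L 𝒬) (hL : 0 < L) :
    (∃ 𝒽, CorridorSupported L 𝒽 ∧ ∀ B c, 𝒬 (𝒽 B) c = B c) ↔ ∀ c, Function.Surjective (bcoef L 𝒬 c) := by
  constructor
  · rintro ⟨𝒽, hs, hinv⟩ c v
    refine ⟨𝒽 (fun _ => v) (b0Z L c), ?_⟩
    rw [← h𝒬.apply_of_supported hL hs]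
    exact hinv _ c
  · intro H
    refine ⟨hOp (b0Z L) (fun c => Function.surjInv (H c)), corridorSupported_hOp L _, ?_⟩
    exact (h𝒬.hOp_rightInverse_iff hL _).2 fun c v => Function.surjInv_eq (H c) v

/-- [folklore] **UNIQUENESS** («Of course h is uniquely defined by these conditions»): if every corridor coefficient
is ONE-TO-ONE, two corridor-supported right inverses coincide. -/
theorem IsQppLocal.rightInverse_unique (h𝒬 : IsQppLocal L 𝒬) (hL : 0 < L)
    (hinj : ∀ c, Function.Injective (bcoef L 𝒬 c)) {𝒽₁ 𝒽₂ : (ZdEdge d → V) → ZdEdge d → V}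
    (hs₁ : CorridorSupported L 𝒽₁) (hs₂ : CorridorSupported L 𝒽₂)
    (h₁ : ∀ B c, 𝒬 (𝒽₁ B) c = B c) (h₂ : ∀ B c, 𝒬 (𝒽₂ B) c = B c) : 𝒽₁ = 𝒽₂ := by
  funext B b
  by_cases hb : ∃ c, b0Z L c = b
  · obtain ⟨c, rfl⟩ := hb
    apply hinj c
    rw [← h𝒬.apply_of_supported hL hs₁, ← h𝒬.apply_of_supported hL hs₂, h₁, h₂]
  · rw [hs₁ B b hb, hs₂ B b hb]

/-- [folklore] **«in fact it is a very simple operator given by the equality (hB)(b₀(c)) = h(c)B(c)»**: with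
one-to-one corridor coefficients, ANY corridor-supported right inverse is the diagonal operator `hOp b₀ h` with
`h(c)v := (𝒽 v̄)(b₀(c))` (`v̄` the constant field) — it is forced to act bond-by-bond. -/
theorem IsQppLocal.eq_hOp_of_rightInverse (h𝒬 : IsQppLocal L 𝒬) (hL : 0 < L)
    (hinj : ∀ c, Function.Injective (bcoef L 𝒬 c)) {𝒽 : (ZdEdge d → V) → ZdEdge d → V}
    (hs : CorridorSupported L 𝒽) (hinv : ∀ B c, 𝒬 (𝒽 B) c = B c) :
    𝒽 = hOp (b0Z L) (fun c v => 𝒽 (fun _ => v) (b0Z L c)) := by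
  refine h𝒬.rightInverse_unique hL hinj hs (corridorSupported_hOp L _) hinv ?_
  refine (h𝒬.hOp_rightInverse_iff hL _).2 fun c v => ?_
  rw [← h𝒬.apply_of_supported hL hs]
  exact hinv _ c

/-- [folklore] and then `h(c)` is a two-sided inverse of `K(c)`: `K(c)(h(c)v) = v` … -/
theorem IsQppLocal.bcoef_h_of_rightInverse (h𝒬 : IsQppLocal L 𝒬) (hL : 0 < L)
    {𝒽 : (ZdEdge d → V) → ZdEdge d → V} (hs : CorridorSupported L 𝒽) (hinv : ∀ B c, 𝒬 (𝒽 B) c = B c)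
    (c : ZdEdge d) (v : V) : bcoef L 𝒬 c (𝒽 (fun _ => v) (b0Z L c)) = v := by
  rw [← h𝒬.apply_of_supported hL hs]
  exact hinv _ c

/-- [folklore] … and `h(c)(K(c)v) = v` once `K(c)` is one-to-one. -/
theorem IsQppLocal.h_bcoef_of_rightInverse (h𝒬 : IsQppLocal L 𝒬) (hL : 0 < L)
    (hinj : ∀ c, Function.Injective (bcoef L 𝒬 c)) {𝒽 : (ZdEdge d → V) → ZdEdge d → V}
    (hs : CorridorSupported L 𝒽) (hinv : ∀ B c, 𝒬 (𝒽 B) c = B c) (c : ZdEdge d) (v : V) :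
    𝒽 (fun _ => bcoef L 𝒬 c v) (b0Z L c) = v :=
  hinj c (h𝒬.bcoef_h_of_rightInverse hL hs hinv c _)

end Local

/-! ## §3  The typed main term `Q0 = LQ₀` ([B7] p. 28 / L × (125)) is `B(c₋) ∪ B(c₊)`-local; its corridor coefficient -/

section MainTerm

variable {G V : Type*} [Monoid G] [AddCommGroup V] [DistribMulAction G V] [Module ℝ V]

/-- [folklore] every bond `(x + l e_μ, μ)`, `l < L`, of the straight contour `[x, x(c)]` from `x ∈ B(c₋)` lies in
`B(c₋) ∪ B(c₊)` (both endpoints; [2] (1.8) `x(c) = x + Le_μ ∈ B(c₊)`). -/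
theorem line_bond_mem_qppBonds {L : ℕ} (hL : 0 < L) (c : ZdEdge d) {x : Fin d → ℤ} (hx : x ∈ blockSites L c.1)
    {l : ℕ} (hl : l < L) : ((x + Pi.single c.2 (l : ℤ), c.2) : ZdEdge d) ∈ qppBonds L c := by
  obtain ⟨y, μ⟩ := c
  rw [mem_qppBonds]
  refine ⟨line_mem_twoBlocks hL μ hx (by positivity) (by exact_mod_cast hl.le), ?_⟩
  dsimp only
  rw [add_assoc, ← Pi.single_add]
  exact line_mem_twoBlocks hL μ hx (by positivity) (by omega)

/-- [cite: Balaban1985Averaging, Prop.4 p.38] for the TYPED MAIN TERM: `(Q₀A)(c)` depends on `A_b`,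
`b ⊂ B(c₋) ∪ B(c₊)` only — here a one-line theorem, since `Q0` sums over the straight contours `[x, x(c)]`,
`x ∈ B(c₋)` (the printed Prop. 4 is about the full non-linear average and is NOT asserted). -/
theorem isQppLocal_Q0 {L : ℕ} (hL : 0 < L) (T : (Fin d → ℤ) → G) (R : ZdEdge d → G) :
    IsQppLocal L (Q0 L T R : (ZdEdge d → V) → ZdEdge d → V) := by
  intro A A' c h
  simp only [Q0_apply, lineRA]
  refine sum_congr rfl fun x hx => ?_
  congr 1
  refine sum_congr rfl fun l hl => ?_
  rw [h _ (line_bond_mem_qppBonds hL c hx (mem_range.1 hl))]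

/-- [folklore] `x_l(c) := L·c₋ + (L − 1 − l)e_μ`: the site of the axis line of `B(c₋)` in direction `μ = c.2` at
distance `l` before `b₀(c)₋` — the `L` sites `x ∈ B(c₋)` whose straight contour `[x, x(c)]` passes through `b₀(c)`. -/
def axisSite (L : ℕ) (c : ZdEdge d) (l : ℕ) : Fin d → ℤ := blockBase L c.1 + Pi.single c.2 ((L : ℤ) - 1 - l)

/-- [folklore] `x_l(c) + l e_μ = b₀(c)₋`. -/
theorem axisSite_add_single (L : ℕ) (c : ZdEdge d) (l : ℕ) :
    axisSite L c l + Pi.single c.2 (l : ℤ) = (b0Z L c).1 := by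
  simp only [axisSite, b0Z, add_assoc, ← Pi.single_add, sub_add_cancel]

/-- [folklore] the `l`-th bond of the contour from `x` is `b₀(c)` iff `x = x_l(c)`. -/
theorem bond_eq_b0Z_iff (L : ℕ) (c : ZdEdge d) (x : Fin d → ℤ) (l : ℕ) :
    ((x + Pi.single c.2 (l : ℤ), c.2) : ZdEdge d) = b0Z L c ↔ x = axisSite L c l := by
  constructor
  · intro h
    have h1 : x + Pi.single c.2 (l : ℤ) = axisSite L c l + Pi.single c.2 (l : ℤ) := by
      rw [axisSite_add_single]; exact congrArg Prod.fst h
    exact add_right_cancel h1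
  · rintro rfl
    exact Prod.ext (axisSite_add_single L c l) rfl

/-- [folklore] `x_l(c) ∈ B(c₋)` for `l < L`. -/
theorem axisSite_mem_blockSites {L : ℕ} (hL : 0 < L) (c : ZdEdge d) {l : ℕ} (hl : l < L) :
    axisSite L c l ∈ blockSites L c.1 := by
  haveI : NeZero L := ⟨hL.ne'⟩
  rw [mem_blockSites_iff]
  refine blockMap_blockBase_add_of_lt L c.1 _ (fun i => ?_) (fun i => ?_)
  · by_cases hi : i = c.2
    · subst hi; simp only [Pi.single_eq_same]; omega
    · simp only [Pi.single_eq_of_ne hi]; exact le_rfl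
  · by_cases hi : i = c.2
    · subst hi; simp only [Pi.single_eq_same]; omega
    · simp only [Pi.single_eq_of_ne hi]; exact_mod_cast hL

/-- [folklore] THE CORRIDOR COEFFICIENT OF THE TYPED MAIN TERM, in closed form:
`K(c) v = L⁻ᵈ Σ_{l<L} R(V₀(Γ_{c₋,x_l(c)} ∪ [x_l(c), b₀(c)₋])) v` — one transported copy of `v` for each of the `L`
sites of `B(c₋)` on the line of `c`, weight `L⁻ᵈ` (p. 28) each. -/
def coef (L : ℕ) (T : (Fin d → ℤ) → G) (R : ZdEdge d → G) (c : ZdEdge d) (v : V) : V :=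
  ((L : ℝ) ^ d)⁻¹ • ∑ l ∈ range L, (T (axisSite L c l) * lineR R (axisSite L c l) c.2 l) • v

/-- [folklore] **`(Q₀A)(c) = K(c)(A(b₀(c)))` for every `A` vanishing on `B(c₋) ∪ B(c₊)` off `b₀(c)`** (the `L`
contours through `b₀(c)` are those from the axis sites `x_l(c)`, the `l`-th bond of the `l`-th one). -/
theorem Q0_eq_coef {L : ℕ} (hL : 0 < L) (T : (Fin d → ℤ) → G) (R : ZdEdge d → G) {A : ZdEdge d → V}
    {c : ZdEdge d} (hA : ∀ b ∈ qppBonds L c, b ≠ b0Z L c → A b = 0) :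
    Q0 L T R A c = coef L T R c (A (b0Z L c)) := by
  rw [Q0_apply, ← smul_sum, coef]
  congr 1
  simp only [lineRA]
  rw [sum_comm]
  refine sum_congr rfl fun l hl => ?_
  have hl' := mem_range.1 hl
  rw [sum_eq_single_of_mem (axisSite L c l) (axisSite_mem_blockSites hL c hl')]
  · rw [(bond_eq_b0Z_iff L c _ l).2 rfl]
  · intro x hx hne
    rw [hA _ (line_bond_mem_qppBonds hL c hx hl') (fun h => hne ((bond_eq_b0Z_iff L c x l).1 h)), smul_zero]

/-- [folklore] the abstract corridor coefficient of § 2 for `𝒬 = Q0` IS `coef`. -/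
theorem bcoef_Q0 {L : ℕ} (hL : 0 < L) (T : (Fin d → ℤ) → G) (R : ZdEdge d → G) (c : ZdEdge d) (v : V) :
    bcoef L (Q0 L T R) c v = coef L T R c v := by
  rw [bcoef, Q0_eq_coef hL T R, Pi.single_eq_same]
  intro b _ hbc
  exact Pi.single_eq_of_ne hbc _

/-- [folklore] as functions. -/
theorem bcoef_Q0_eq {L : ℕ} (hL : 0 < L) (T : (Fin d → ℤ) → G) (R : ZdEdge d → G) (c : ZdEdge d) :
    bcoef L (Q0 L T R : (ZdEdge d → V) → ZdEdge d → V) c = coef L T R c :=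
  funext (bcoef_Q0 hL T R c)

/-- [folklore] **`(Q₀ hB)(c) = K(c) h(c) B(c)`** for every diagonal candidate `h`. -/
theorem Q0_hOp {L : ℕ} (hL : 0 < L) (T : (Fin d → ℤ) → G) (R : ZdEdge d → G) (h : ZdEdge d → V → V)
    (B : ZdEdge d → V) (c : ZdEdge d) : Q0 L T R (hOp (b0Z L) h B) c = coef L T R c (h c (B c)) := by
  rw [(isQppLocal_Q0 hL T R).apply_hOp hL, bcoef_Q0 hL]

/-- [folklore] `K(c)` is additive … -/
theorem coef_add (L : ℕ) (T : (Fin d → ℤ) → G) (R : ZdEdge d → G) (c : ZdEdge d) (v w : V) :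
    coef L T R c (v + w) = coef L T R c v + coef L T R c w := by
  simp only [coef, smul_add, sum_add_distrib]

/-- [folklore] … and `K(c) 0 = 0`. -/
@[simp] theorem coef_zero (L : ℕ) (T : (Fin d → ℤ) → G) (R : ZdEdge d → G) (c : ZdEdge d) :
    coef L T R c (0 : V) = 0 := by
  simp only [coef, smul_zero, sum_const_zero]

variable [SMulCommClass G ℝ V]

/-- [folklore] … and `ℝ`-homogeneous («h(c) is a linear operator on the Lie algebra g»). -/
theorem coef_smul (L : ℕ) (T : (Fin d → ℤ) → G) (R : ZdEdge d → G) (c : ZdEdge d) (r : ℝ) (v : V) :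
    coef L T R c (r • v) = r • coef L T R c v := by
  simp only [coef, smul_comm _ r v, ← smul_sum, smul_comm _ r]

/-- [folklore] `K(c)` as an `ℝ`-linear map. -/
def coefₗ (L : ℕ) (T : (Fin d → ℤ) → G) (R : ZdEdge d → G) (c : ZdEdge d) : V →ₗ[ℝ] V where
  toFun := coef L T R c
  map_add' := coef_add L T R c
  map_smul' := coef_smul L T R c

/-- [folklore] unfolding. -/
@[simp] theorem coefₗ_apply (L : ℕ) (T : (Fin d → ℤ) → G) (R : ZdEdge d → G) (c : ZdEdge d) (v : V) :
    coefₗ L T R c v = coef L T R c v := rfl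

end MainTerm

/-! ## §4  Straight axis contours: `K(c) = L¹⁻ᵈ·R(V₀([L c₋, b₀(c)₋]))`, the operator `h`, `LQ̃h = I`, uniqueness, the
`L⁻¹`-formula -/

section StraightMonoid

variable {G V : Type*} [Monoid G] [AddCommGroup V] [DistribMulAction G V] [Module ℝ V]

/-- [cite: Balaban1984PropagatorsI, (1.7) p.18] read on the axis lines: the contour `Γ_{y,x}` from the block base
point to a site `x = L y + t e_μ` ON AN AXIS LINE of the block is the straight segment, so its transporter is
`R(V₀([L y, L y + t e_μ]))`.  This is the only property of the contours used below (it holds for the contours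
(1.7) of [2]: `axisStraight_gammaT`). -/
def AxisStraight (L : ℕ) (T : (Fin d → ℤ) → G) (R : ZdEdge d → G) : Prop :=
  ∀ (y : Fin d → ℤ) (μ : Fin d) (t : ℕ), t < L →
    T (blockBase L y + Pi.single μ (t : ℤ)) = lineR R (blockBase L y) μ t

/-- [folklore] `g(c) := R(V₀([L c₋, L c₋ + (L−1)e_μ]))`, the straight transporter from the base point of `B(c₋)` to
`b₀(c)₋` along the line of `c`. -/
def gcorner (L : ℕ) (R : ZdEdge d → G) (c : ZdEdge d) : G := lineR R (blockBase L c.1) c.2 (L - 1)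

variable {L : ℕ} {T : (Fin d → ℤ) → G} {R : ZdEdge d → G}

/-- [folklore] under `AxisStraight`, each of the `L` transports `R(V₀(Γ_{c₋,x_l(c)} ∪ [x_l(c), b₀(c)₋]))` equals
`g(c)` (concatenation of straight segments on one line). -/
theorem transport_eq_gcorner (hT : AxisStraight L T R) (c : ZdEdge d) {l : ℕ} (hl : l < L) :
    T (axisSite L c l) * lineR R (axisSite L c l) c.2 l = gcorner L R c := by
  have hcast : ((L - 1 - l : ℕ) : ℤ) = (L : ℤ) - 1 - l := by omega
  have hx : axisSite L c l = blockBase L c.1 + Pi.single c.2 ((L - 1 - l : ℕ) : ℤ) := by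
    rw [hcast]; rfl
  rw [hx, hT c.1 c.2 (L - 1 - l) (by omega), ← lineR_add, gcorner]
  congr 1
  omega

/-- [folklore] **THE CORRIDOR COEFFICIENT UNDER STRAIGHT AXIS CONTOURS: `K(c)v = L⁻ᵈ·L·g(c)v = L¹⁻ᵈ R(V₀(…))v`**
(«L of the Lᵈ straight paths run through the unique corridor bond on the line of c», cell GAPS G-adv9-22 (U2)). -/
theorem coef_eq_of_axisStraight (hT : AxisStraight L T R) (c : ZdEdge d) (v : V) :
    coef L T R c v = (((L : ℝ) ^ d)⁻¹ * L) • (gcorner L R c • v) := by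
  rw [coef, sum_congr rfl fun l hl => by rw [transport_eq_gcorner hT c (mem_range.1 hl)], sum_const, card_range,
    ← Nat.cast_smul_eq_nsmul ℝ, smul_smul]

end StraightMonoid

section Straight

variable {G V : Type*} [Group G] [AddCommGroup V] [DistribMulAction G V] [Module ℝ V]
  {L : ℕ} {T : (Fin d → ℤ) → G} {R : ZdEdge d → G}

/-- [cite: Balaban1987RG1, p.267] **`h(c)`** for the typed main term: `h(c)v := (Lᵈ/L)·g(c)⁻¹v = L^{d−1} R(V₀(…))⁻¹ v`
(«a linear operator on the Lie algebra g, equal to an inverse of a coefficient at the variable B′(b₀(c)) in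
(Q̃B′)(c), multiplied by L⁻¹» — `hMain_eq_inv_coefQt` below). -/
def hMain (L : ℕ) (R : ZdEdge d → G) (c : ZdEdge d) (v : V) : V := ((L : ℝ) ^ d / L) • ((gcorner L R c)⁻¹ • v)

/-- [folklore] `h(c)` is additive. -/
theorem hMain_add (L : ℕ) (R : ZdEdge d → G) (c : ZdEdge d) (v w : V) :
    hMain L R c (v + w) = hMain L R c v + hMain L R c w := by
  simp only [hMain, smul_add]

variable [SMulCommClass G ℝ V]

/-- [folklore] `h(c)` is `ℝ`-homogeneous. -/
theorem hMain_smul (L : ℕ) (R : ZdEdge d → G) (c : ZdEdge d) (r : ℝ) (v : V) :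
    hMain L R c (r • v) = r • hMain L R c v := by
  rw [hMain, hMain, smul_comm (gcorner L R c)⁻¹ r v, smul_comm ((L : ℝ) ^ d / L) r]

/-- [folklore] `K(c)(h(c)v) = v`. -/
theorem coef_hMain (hT : AxisStraight L T R) (hL : 0 < L) (c : ZdEdge d) (v : V) :
    coef L T R c (hMain L R c v) = v := by
  have hLr : (L : ℝ) ≠ 0 := by exact_mod_cast hL.ne'
  rw [coef_eq_of_axisStraight hT, hMain, smul_comm (gcorner L R c) ((L : ℝ) ^ d / L), smul_inv_smul, smul_smul,
    show ((L : ℝ) ^ d)⁻¹ * L * ((L : ℝ) ^ d / L) = 1 by field_simp, one_smul]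

/-- [folklore] `h(c)(K(c)v) = v`. -/
theorem hMain_coef (hT : AxisStraight L T R) (hL : 0 < L) (c : ZdEdge d) (v : V) :
    hMain L R c (coef L T R c v) = v := by
  have hLr : (L : ℝ) ≠ 0 := by exact_mod_cast hL.ne'
  rw [coef_eq_of_axisStraight hT, hMain, smul_comm (gcorner L R c)⁻¹ (((L : ℝ) ^ d)⁻¹ * L), inv_smul_smul,
    smul_smul, show (L : ℝ) ^ d / L * (((L : ℝ) ^ d)⁻¹ * L) = 1 by field_simp, one_smul]

/-- [folklore] hence `K(c)` is a bijection of the fibre (invertibility of the corridor coefficient — the point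
«needs exactly its invertibility» of GAPS G-adv9-22 (U2), PROVED for the typed main term). -/
theorem coef_bijective (hT : AxisStraight L T R) (hL : 0 < L) (c : ZdEdge d) :
    Function.Bijective (coef L T R c : V → V) :=
  ⟨Function.LeftInverse.injective (hMain_coef hT hL c), Function.RightInverse.surjective (coef_hMain hT hL c)⟩

/-- [cite: Balaban1987RG1, p.267] **«the operator h satisfies the identity LQ̃h = I on T⁽ᵏ⁺¹⁾»** for the typed main
term: `Q₀(hB) = B` for EVERY coarse-bond field `B` (exact lattice identity; no smallness). -/
theorem Q0_hOp_hMain (hT : AxisStraight L T R) (hL : 0 < L) (B : ZdEdge d → V) (c : ZdEdge d) :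
    Q0 L T R (hOp (b0Z L) (hMain L R) B) c = B c := by
  rw [Q0_hOp hL, coef_hMain hT hL]

/-- [folklore] the converse identity **`h(LQ̃A) = A` on `b₀`-supported fields** (cell GAPS C-adv9-23 (a): «conversely
hLQ̃ = I on b₀-supported functions because (Q̃B)(c) sees B(b₀(c′)) only for c′ = c»). -/
theorem hOp_hMain_Q0 (hT : AxisStraight L T R) (hL : 0 < L) {A : ZdEdge d → V}
    (hA : ∀ b, (¬ ∃ c, b0Z L c = b) → A b = 0) : hOp (b0Z L) (hMain L R) (Q0 L T R A) = A := by
  funext b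
  by_cases hb : ∃ c, b0Z L c = b
  · obtain ⟨c, rfl⟩ := hb
    rw [hOp_apply_b₀ (b0Z_injective hL), Q0_eq_coef hL T R, hMain_coef hT hL]
    intro b' hb' hne
    refine hA b' ?_
    rintro ⟨c', rfl⟩
    exact hne (congrArg (b0Z L) (eq_of_b0Z_mem_qppBonds hL hb'))
  · rw [hOp_eq_zero_off_range _ _ hb, hA b hb]

/-- [cite: Balaban1987RG1, p.267] **«Of course h is uniquely defined by these conditions»**: a corridor-supported
operator `𝒽` with `Q₀(𝒽B) = B` for all `B` IS `hOp b₀ hMain`. -/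
theorem eq_hOp_hMain (hT : AxisStraight L T R) (hL : 0 < L) {𝒽 : (ZdEdge d → V) → ZdEdge d → V}
    (hs : CorridorSupported L 𝒽) (hinv : ∀ B c, Q0 L T R (𝒽 B) c = B c) : 𝒽 = hOp (b0Z L) (hMain L R) :=
  (isQppLocal_Q0 hL T R).rightInverse_unique hL
    (fun c => by rw [bcoef_Q0_eq hL]; exact (coef_bijective hT hL c).1)
    hs (corridorSupported_hOp L _) hinv (Q0_hOp_hMain hT hL)

/-- [folklore] in particular among the diagonal operators: `Q₀ ∘ hOp b₀ h = id` iff `h = hMain`. -/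
theorem hOp_rightInverse_iff_eq_hMain (hT : AxisStraight L T R) (hL : 0 < L) (h : ZdEdge d → V → V) :
    (∀ B c, Q0 L T R (hOp (b0Z L) h B) c = B c) ↔ h = hMain L R := by
  constructor
  · intro H
    funext c v
    have := ((isQppLocal_Q0 hL T R).hOp_rightInverse_iff hL h).1 H c v
    rw [bcoef_Q0 hL] at this
    rw [← hMain_coef hT hL c (h c v), this]
  · rintro rfl
    exact Q0_hOp_hMain hT hL

/-- [folklore] THE NORMALISED COEFFICIENT: `Q̃ = L⁻¹·(LQ̃)` is the linear averaging normalised so that constants go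
to constants ([2] (1.11) = [B7] (125), weight `L⁻⁽ᵈ⁺¹⁾`; `B7Eq61Linearization.Q0_const_one`), so «a coefficient at
the variable B′(b₀(c)) in (Q̃B′)(c)» is `L⁻¹K(c) = L⁻ᵈ·g(c)` — packaged with its inverse as a linear equivalence. -/
def coefQt (hT : AxisStraight L T R) (hL : 0 < L) (c : ZdEdge d) : V ≃ₗ[ℝ] V where
  toFun v := (L : ℝ)⁻¹ • coef L T R c v
  invFun w := (L : ℝ) • hMain L R c w
  map_add' v w := by rw [coef_add, smul_add]
  map_smul' r v := by rw [coef_smul, smul_comm, RingHom.id_apply]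
  left_inv v := by
    have hLr : (L : ℝ) ≠ 0 := by exact_mod_cast hL.ne'
    show (L : ℝ) • hMain L R c ((L : ℝ)⁻¹ • coef L T R c v) = v
    rw [hMain_smul, smul_smul, mul_inv_cancel₀ hLr, one_smul, hMain_coef hT hL]
  right_inv w := by
    have hLr : (L : ℝ) ≠ 0 := by exact_mod_cast hL.ne'
    show (L : ℝ)⁻¹ • coef L T R c ((L : ℝ) • hMain L R c w) = w
    rw [coef_smul, smul_smul, inv_mul_cancel₀ hLr, one_smul, coef_hMain hT hL]

/-- [folklore] unfolding: the normalised coefficient is `L⁻ᵈ g(c)`. -/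
theorem coefQt_apply (hT : AxisStraight L T R) (hL : 0 < L) (c : ZdEdge d) (v : V) :
    coefQt hT hL c v = ((L : ℝ) ^ d)⁻¹ • (gcorner L R c • v) := by
  have hLr : (L : ℝ) ≠ 0 := by exact_mod_cast hL.ne'
  show (L : ℝ)⁻¹ • coef L T R c v = _
  rw [coef_eq_of_axisStraight hT, smul_smul]
  congr 1
  field_simp

/-- [cite: Balaban1987RG1, p.267] **«h(c) is … equal to an inverse of a coefficient at the variable B′(b₀(c)) in
(Q̃B′)(c), multiplied by L⁻¹»**, literally: `h(c) = L⁻¹ · (coefQt c)⁻¹`. -/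
theorem hMain_eq_inv_coefQt (hT : AxisStraight L T R) (hL : 0 < L) (c : ZdEdge d) (v : V) :
    hMain L R c v = (L : ℝ)⁻¹ • (coefQt hT hL c).symm v := by
  have hLr : (L : ℝ) ≠ 0 := by exact_mod_cast hL.ne'
  show hMain L R c v = (L : ℝ)⁻¹ • ((L : ℝ) • hMain L R c v)
  rw [smul_smul, inv_mul_cancel₀ hLr, one_smul]

/-- [folklore] `Lᵈ/L = L^{d−1}` for `d ≥ 1` (so `h(c) = L^{d−1} g(c)⁻¹`; at `d = 4`: `L³`). -/
theorem pow_div_self_eq {L : ℕ} (hL : 0 < L) (hd : 1 ≤ d) : (L : ℝ) ^ d / L = (L : ℝ) ^ (d - 1) := by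
  have hLr : (L : ℝ) ≠ 0 := by exact_mod_cast hL.ne'
  rw [div_eq_iff hLr, ← pow_succ, Nat.sub_add_cancel hd]

/-- [folklore] ITEM 7 OF `Beta.ConstraintElimination` («whether Bałaban's coefficient has this shape is NOT asserted
here»), settled for the typed main term: the corridor coefficient is a SCALAR times the fibre action of ONE group
element, `K(c) = (L·L⁻ᵈ) • ρ(g(c))`. -/
theorem coefₗ_eq_smul_toLinearMap (hT : AxisStraight L T R) (c : ZdEdge d) :
    coefₗ (V := V) L T R c = (((L : ℝ) ^ d)⁻¹ * L) • DistribSMul.toLinearMap ℝ V (gcorner L R c) := by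
  ext v
  rw [coefₗ_apply, coef_eq_of_axisStraight hT, LinearMap.smul_apply, DistribSMul.toLinearMap_apply]

/-- [folklore] hence `det K(c) = (L·L⁻ᵈ)^{dim V} · det ρ(g(c))`, and `|det K(c)| = (L·L⁻ᵈ)^{dim V}` is
BACKGROUND-INDEPENDENT as soon as `|det ρ(g(c))| = 1` (e.g. `ρ = Ad` of a compact group in a tr-orthonormal basis:
`Beta.ConstraintElimination.abs_det_smul_of_transpose_mul_self_eq_one`). -/
theorem det_coefₗ (hT : AxisStraight L T R) (c : ZdEdge d) :
    LinearMap.det (coefₗ (V := V) L T R c) =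
      (((L : ℝ) ^ d)⁻¹ * L) ^ Module.finrank ℝ V * LinearMap.det (DistribSMul.toLinearMap ℝ V (gcorner L R c)) := by
  rw [coefₗ_eq_smul_toLinearMap hT, LinearMap.det_smul]

/-- [folklore] the background-free absolute Jacobian factor per coarse bond. -/
theorem abs_det_coefₗ (hT : AxisStraight L T R) (c : ZdEdge d)
    (h1 : |LinearMap.det (DistribSMul.toLinearMap ℝ V (gcorner L R c))| = 1) :
    |LinearMap.det (coefₗ (V := V) L T R c)| = (((L : ℝ) ^ d)⁻¹ * L) ^ Module.finrank ℝ V := by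
  rw [det_coefₗ hT, abs_mul, h1, mul_one, abs_pow, abs_of_nonneg (by positivity)]

end Straight

/-! ## §4b  Linear packaging; the binder `hLQh : ∀ X, LQ (hop X) = X` of `B12Lineariz267` § 1 DISCHARGED for the
typed main term by the explicit operator -/

section Linear

variable {G V : Type*} [Monoid G] [AddCommGroup V] [DistribMulAction G V]

/-- [folklore] `R_{0,c₋}` (sum form) is additive. -/
theorem lineRA_add (L : ℕ) (T : (Fin d → ℤ) → G) (R : ZdEdge d → G) (A A' : ZdEdge d → V) (x : Fin d → ℤ)
    (μ : Fin d) : lineRA L T R (A + A') x μ = lineRA L T R A x μ + lineRA L T R A' x μ := by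
  simp only [lineRA, Pi.add_apply, smul_add, sum_add_distrib]

variable [Module ℝ V]

/-- [folklore] `Q₀` is additive. -/
theorem Q0_add (L : ℕ) (T : (Fin d → ℤ) → G) (R : ZdEdge d → G) (A A' : ZdEdge d → V) (c : ZdEdge d) :
    Q0 L T R (A + A') c = Q0 L T R A c + Q0 L T R A' c := by
  simp only [Q0_apply, lineRA_add, smul_add, sum_add_distrib]

variable [SMulCommClass G ℝ V]

/-- [folklore] `R_{0,c₋}` (sum form) is `ℝ`-homogeneous. -/
theorem lineRA_smul (L : ℕ) (T : (Fin d → ℤ) → G) (R : ZdEdge d → G) (r : ℝ) (A : ZdEdge d → V) (x : Fin d → ℤ)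
    (μ : Fin d) : lineRA L T R (r • A) x μ = r • lineRA L T R A x μ := by
  simp only [lineRA, Pi.smul_apply, smul_comm _ r, smul_sum]

/-- [folklore] `Q₀` is `ℝ`-homogeneous. -/
theorem Q0_smul (L : ℕ) (T : (Fin d → ℤ) → G) (R : ZdEdge d → G) (r : ℝ) (A : ZdEdge d → V) (c : ZdEdge d) :
    Q0 L T R (r • A) c = r • Q0 L T R A c := by
  simp only [Q0_apply, lineRA_smul, smul_comm _ r, smul_sum]

/-- [folklore] the typed main term `LQ̃ := Q₀` as an `ℝ`-linear map from fine-bond fields to coarse-bond fields (the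
carrier shape `LQ : 𝒴 →ₗ[𝕜] 𝒳` of `B12Lineariz267` § 1). -/
def Q0ₗ (L : ℕ) (T : (Fin d → ℤ) → G) (R : ZdEdge d → G) : (ZdEdge d → V) →ₗ[ℝ] (ZdEdge d → V) where
  toFun := Q0 L T R
  map_add' A A' := funext (Q0_add L T R A A')
  map_smul' r A := funext (Q0_smul L T R r A)

/-- [folklore] unfolding. -/
@[simp] theorem Q0ₗ_apply (L : ℕ) (T : (Fin d → ℤ) → G) (R : ZdEdge d → G) (A : ZdEdge d → V) :
    Q0ₗ L T R A = Q0 L T R A := rfl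

/-- [folklore] a diagonal operator `hOp b₀ h` with linear `h(c)` is linear (the carrier shape `hop : 𝒳 →ₗ[𝕜] 𝒴`). -/
def hOpₗ {L : ℕ} (hL : 0 < L) (h : ZdEdge d → V →ₗ[ℝ] V) : (ZdEdge d → V) →ₗ[ℝ] (ZdEdge d → V) where
  toFun := hOp (b0Z L) (fun c => h c)
  map_add' B B' := by
    funext b
    by_cases hb : ∃ c, b0Z L c = b
    · obtain ⟨c, rfl⟩ := hb
      simp only [Pi.add_apply, hOp_apply_b₀ (b0Z_injective hL), map_add]
    · simp only [Pi.add_apply, hOp_eq_zero_off_range _ _ hb, add_zero]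
  map_smul' r B := by
    funext b
    by_cases hb : ∃ c, b0Z L c = b
    · obtain ⟨c, rfl⟩ := hb
      simp only [Pi.smul_apply, hOp_apply_b₀ (b0Z_injective hL), map_smul, RingHom.id_apply]
    · simp only [Pi.smul_apply, hOp_eq_zero_off_range _ _ hb, smul_zero, RingHom.id_apply]

/-- [folklore] unfolding. -/
@[simp] theorem hOpₗ_apply {L : ℕ} (hL : 0 < L) (h : ZdEdge d → V →ₗ[ℝ] V) (B : ZdEdge d → V) :
    hOpₗ hL h B = hOp (b0Z L) (fun c => h c) B := rfl

end Linear

section LinearGroup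

variable {G V : Type*} [Group G] [AddCommGroup V] [DistribMulAction G V] [Module ℝ V] [SMulCommClass G ℝ V]
  {L : ℕ} {T : (Fin d → ℤ) → G} {R : ZdEdge d → G}

/-- [folklore] `h(c)` as an `ℝ`-linear map («h(c) is a linear operator on the Lie algebra g»). -/
def hMainₗ (L : ℕ) (R : ZdEdge d → G) (c : ZdEdge d) : V →ₗ[ℝ] V where
  toFun := hMain L R c
  map_add' := hMain_add L R c
  map_smul' := hMain_smul L R c

/-- [folklore] unfolding. -/
@[simp] theorem hMainₗ_apply (L : ℕ) (R : ZdEdge d → G) (c : ZdEdge d) (v : V) : hMainₗ L R c v = hMain L R c v :=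
  rfl

/-- [cite: Balaban1987RG1, p.267] **THE BINDER `hLQh : ∀ X, LQ (hop X) = X` OF `B12Lineariz267` § 1 («LQ̃h = I»),
DISCHARGED**: for the typed main term and the explicit `h`, it is a theorem. -/
theorem hLQh_main (hT : AxisStraight L T R) (hL : 0 < L) (X : ZdEdge d → V) :
    Q0ₗ L T R (hOpₗ hL (hMainₗ L R) X) = X :=
  funext fun c => Q0_hOp_hMain hT hL X c

/-- [cite: Balaban1987RG1, p.267] hence the p. 267 display «LQ̃B′ + C̃(B′) = LQ̃B − D̃(B) + C̃(B − hD̃(B)) = LQ̃B»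
(`B12Lineariz267.linearizes`, BY NAME) holds for the typed `LQ̃ = Q₀`, the explicit `h`, ANY function `C̃` and any
`D` solving `C̃(B − hD) = D` — the `h`-hypothesis of that module is no longer an assumption here. -/
theorem linearizes_main (hT : AxisStraight L T R) (hL : 0 < L) (Ct : (ZdEdge d → V) → ZdEdge d → V)
    {B D : ZdEdge d → V} (hfix : Ct (B - hOpₗ hL (hMainₗ L R) D) = D) :
    Q0ₗ L T R (B - hOpₗ hL (hMainₗ L R) D) + Ct (B - hOpₗ hL (hMainₗ L R) D) = Q0ₗ L T R B :=
  B12Lineariz267.linearizes (Ct := Ct) (hLQh_main hT hL) hfix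

/-- [folklore] and the δ-surface `{LQ̃B′ + C̃(B′) = 0}` is the preimage of the linear subspace `{Q₀ = 0}` under
`B′ ↦ B′ + hC̃(B′)` (`B12Lineariz267.constraint_eq_zero_iff`, BY NAME). -/
theorem constraint_eq_zero_iff_main (hT : AxisStraight L T R) (hL : 0 < L) (Ct : (ZdEdge d → V) → ZdEdge d → V)
    (B' : ZdEdge d → V) :
    Q0ₗ L T R B' + Ct B' = 0 ↔ Q0ₗ L T R (B' + hOpₗ hL (hMainₗ L R) (Ct B')) = 0 :=
  B12Lineariz267.constraint_eq_zero_iff (Ct := Ct) (hLQh_main hT hL) B'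

end LinearGroup

/-! ## §5  The norm `‖h(c)‖ = B₀′ = L^{d−1}` in the adjoint action ([B7] (56) `R(X)Y = XYX⁻¹`) -/

section Norm

variable {A : Type*} [NormedRing A]

/-- [folklore] a product of units of norm `≤ 1` has norm `≤ 1` (with `‖1‖ = 1` for the empty product). -/
theorem norm_ofConjAct_pathProd_le_one [NormOneClass A] (g : ℕ → ConjAct Aˣ)
    (hg : ∀ t, ‖((ConjAct.ofConjAct (g t) : Aˣ) : A)‖ ≤ 1) :
    ∀ n, ‖((ConjAct.ofConjAct (pathProd g n) : Aˣ) : A)‖ ≤ 1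
  | 0 => by rw [pathProd_zero, map_one, Units.val_one, norm_one]
  | n + 1 => by
    rw [pathProd_succ, map_mul, Units.val_mul]
    exact (norm_mul_le _ _).trans (mul_le_one₀ (norm_ofConjAct_pathProd_le_one g hg n) (norm_nonneg _) (hg n))

/-- [folklore] … and so has its inverse if the inverses of the factors have norm `≤ 1`. -/
theorem norm_ofConjAct_pathProd_inv_le_one [NormOneClass A] (g : ℕ → ConjAct Aˣ)
    (hg : ∀ t, ‖(((ConjAct.ofConjAct (g t))⁻¹ : Aˣ) : A)‖ ≤ 1) :
    ∀ n, ‖(((ConjAct.ofConjAct (pathProd g n))⁻¹ : Aˣ) : A)‖ ≤ 1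
  | 0 => by rw [pathProd_zero, map_one, inv_one, Units.val_one, norm_one]
  | n + 1 => by
    rw [pathProd_succ, map_mul, mul_inv_rev, Units.val_mul]
    exact (norm_mul_le _ _).trans
      (mul_le_one₀ (hg n) (norm_nonneg _) (norm_ofConjAct_pathProd_inv_le_one g hg n))

variable [NormedAlgebra ℝ A]

/-- [folklore] **`‖h(c)X‖ ≤ (Lᵈ/L)‖X‖`** when the transporter `g(c)` and its inverse have operator norm `≤ 1`
(unitarity in the operator norm, as in `B7Eq61Linearization` § 4 / `B8CurlGradHolonomy`): the bound `|hB| ≤ B₀′|B|`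
with `B₀′ = L^{d−1}` of cell GAPS G-adv9-22 (U2). -/
theorem norm_hMain_le (L : ℕ) (R : ZdEdge d → ConjAct Aˣ) (c : ZdEdge d) (X : A)
    (hg : ‖((ConjAct.ofConjAct (gcorner L R c) : Aˣ) : A)‖ ≤ 1)
    (hg' : ‖(((ConjAct.ofConjAct (gcorner L R c))⁻¹ : Aˣ) : A)‖ ≤ 1) :
    ‖hMain L R c X‖ ≤ ((L : ℝ) ^ d / L) * ‖X‖ := by
  rw [hMain, norm_smul, Real.norm_of_nonneg (by positivity)]
  refine mul_le_mul_of_nonneg_left ?_ (by positivity)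
  refine norm_conjAct_smul_le _ X ?_ ?_
  · rwa [map_inv]
  · rwa [map_inv, inv_inv]

/-- [folklore] **`‖h(c)X‖ = (Lᵈ/L)‖X‖`** when conjugation by `g(c)` is isometric (unitary matrices): the bound
`B₀′ = L^{d−1}` is attained. -/
theorem norm_hMain_eq (L : ℕ) (R : ZdEdge d → ConjAct Aˣ) (c : ZdEdge d) (X : A)
    (hiso : ∀ Y : A, ‖(gcorner L R c)⁻¹ • Y‖ = ‖Y‖) : ‖hMain L R c X‖ = ((L : ℝ) ^ d / L) * ‖X‖ := by
  rw [hMain, norm_smul, Real.norm_of_nonneg (by positivity), hiso]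

/-- [folklore] **`‖h(c)X‖ ≤ L^{d−1}‖X‖` from BONDWISE unitarity** `‖U(b)‖ ≤ 1`, `‖U(b)⁻¹‖ ≤ 1` (the regime of [B12]:
`G`-valued bond variables in the operator norm; `‖1‖ = 1`). -/
theorem norm_hMain_le_of_bond [NormOneClass A] (L : ℕ) (R : ZdEdge d → ConjAct Aˣ) (c : ZdEdge d) (X : A)
    (hR : ∀ b, ‖((ConjAct.ofConjAct (R b) : Aˣ) : A)‖ ≤ 1)
    (hR' : ∀ b, ‖(((ConjAct.ofConjAct (R b))⁻¹ : Aˣ) : A)‖ ≤ 1) :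
    ‖hMain L R c X‖ ≤ ((L : ℝ) ^ d / L) * ‖X‖ :=
  norm_hMain_le L R c X (norm_ofConjAct_pathProd_le_one _ (fun _ => hR _) _)
    (norm_ofConjAct_pathProd_inv_le_one _ (fun _ => hR' _) _)

end Norm

/-! ## §6  The flat case and the tree's normalised averaging `B7BlockGeometry.Qav` ([2] (1.11) = [B7] (125)) -/

section FlatMonoid

variable {G : Type*} [Monoid G]

/-- [folklore] trivial transporters are axis-straight. -/
theorem axisStraight_const_one (L : ℕ) :
    AxisStraight L (fun _ : Fin d → ℤ => (1 : G)) (fun _ : ZdEdge d => (1 : G)) :=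
  fun _ _ _ _ => by rw [lineR_const_one]

/-- [folklore] flat `g(c) = 1`. -/
@[simp] theorem gcorner_const_one (L : ℕ) (c : ZdEdge d) : gcorner L (fun _ : ZdEdge d => (1 : G)) c = 1 :=
  lineR_const_one _ _ _

end FlatMonoid

section Flat

variable {G V : Type*} [Group G] [AddCommGroup V] [DistribMulAction G V] [Module ℝ V]

/-- [folklore] flat `h(c) = Lᵈ/L = L^{d−1}` (a scalar). -/
theorem hMain_const_one (L : ℕ) (c : ZdEdge d) (v : V) :
    hMain L (fun _ : ZdEdge d => (1 : G)) c v = ((L : ℝ) ^ d / L) • v := by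
  rw [hMain, gcorner_const_one, inv_one, one_smul]

/-- numeric instance: `d = 4`, `L = 2`, flat ⇒ `h(c) = 2³ = 8`. -/
example (c : ZdEdge 4) (v : V) : hMain 2 (fun _ : ZdEdge 4 => (1 : G)) c v = (8 : ℝ) • v := by
  rw [hMain_const_one]; norm_num

end Flat

section FlatReal

/-- [folklore] **the coefficient of `f(b₀(c))` in the tree's `(Q f)(c)` ([2] (1.11), weight `L⁻⁽ᵈ⁺¹⁾`) is `L⁻ᵈ`**
(`L` of the `Lᵈ·L` pairs `(x, l)` hit `b₀(c)`): the flat normalised corridor coefficient. -/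
theorem Qav_single_b0Z {L : ℕ} (hL : 0 < L) (c : ZdEdge d) (s : ℝ) :
    Qav L (Pi.single (b0Z L c) s) c = ((L : ℝ) ^ d)⁻¹ * s := by
  have hLr : (L : ℝ) ≠ 0 := by exact_mod_cast hL.ne'
  have h1 := Q0_const_one (G := ℝˣ) L hL (Pi.single (b0Z L c) s) c
  have h2 : Q0 L (fun _ : Fin d → ℤ => (1 : ℝˣ)) (fun _ : ZdEdge d => (1 : ℝˣ)) (Pi.single (b0Z L c) s) c
      = (((L : ℝ) ^ d)⁻¹ * L) * s := by
    have hb := bcoef_Q0 (V := ℝ) hL (fun _ : Fin d → ℤ => (1 : ℝˣ)) (fun _ : ZdEdge d => (1 : ℝˣ)) c s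
    simp only [bcoef] at hb
    rw [hb, coef_eq_of_axisStraight (axisStraight_const_one L), gcorner_const_one, one_smul, smul_eq_mul]
  rw [h2] at h1
  have : (L : ℝ) * Qav L (Pi.single (b0Z L c) s) c = (L : ℝ) * (((L : ℝ) ^ d)⁻¹ * s) := by
    rw [← h1]; ring
  exact mul_left_cancel₀ hLr this

/-- [folklore] **flat `LQ̃h = I` by name on `Qav`**: `L · Q(hOp b₀ (L^{d−1}·) B) = B` — the operator `h = L^{d−1}`
(`= (L⁻ᵈ)⁻¹ · L⁻¹`, «inverse of a coefficient … multiplied by L⁻¹») inverts `L·Q` on `b₀`-supported fields. -/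
theorem Qav_hOp {L : ℕ} (hL : 0 < L) (B : ZdEdge d → ℝ) (c : ZdEdge d) :
    (L : ℝ) * Qav L (hOp (b0Z L) (fun _ s => ((L : ℝ) ^ d / L) * s) B) c = B c := by
  have h := Q0_hOp_hMain (V := ℝ) (axisStraight_const_one (G := ℝˣ) L) hL B c
  rw [Q0_const_one L hL] at h
  have hh : (hMain L (fun _ : ZdEdge d => (1 : ℝˣ)) : ZdEdge d → ℝ → ℝ) = fun _ s => ((L : ℝ) ^ d / L) * s := by
    funext c' s
    rw [hMain_const_one, smul_eq_mul]
  rwa [hh] at h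

end FlatReal

/-! ## §7  The contours (1.7) of [2] are axis-straight (satisfiability of `AxisStraight` by the printed contours) -/

section Gamma

variable {G : Type*} [Monoid G]

/-- [cite: Balaban1984PropagatorsI, (1.7) p.18] the intermediate point of `Γ_{y,x}` before the move in (0-based)
direction `i`: coordinates `> i` already those of `x`, coordinates `≤ i` still those of `y`
(«[(y₁, …, y_μ, x_{μ+1}, …, x_d), (y₁, …, x_μ, x_{μ+1}, …, x_d)]», directions taken in the order `d, d−1, …, 1`). -/
def gammaPt (y x : Fin d → ℤ) (i : Fin d) : Fin d → ℤ := fun j => if i < j then x j else y j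

/-- [folklore] a product over a duplicate-free list all of whose factors but (possibly) the one at `μ` are `1`. -/
theorem list_prod_map_eq_of_ne_one {ι : Type*} [DecidableEq ι] (f : ι → G) (μ : ι)
    (hf : ∀ i, i ≠ μ → f i = 1) : ∀ l : List ι, l.Nodup → (l.map f).prod = if μ ∈ l then f μ else 1
  | [], _ => by simp
  | a :: l, hl => by
    rw [List.nodup_cons] at hl
    rw [List.map_cons, List.prod_cons, list_prod_map_eq_of_ne_one f μ hf l hl.2]
    by_cases ha : a = μ
    · subst ha
      simp [hl.1]
    · rw [hf a ha, one_mul]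
      simp [Ne.symm ha]

/-- [cite: Balaban1984PropagatorsI, (1.7) p.18] `R(V₀(Γ_{y,x}))` for the contours (1.7) of [2] on the corner-cube
geometry (`y` = the base point `L·⌊x/L⌋` of the block of `x`; segment in direction `d` first, direction `1` last;
ordered product as in [B7] (9)). -/
def gammaT (L : ℕ) (R : ZdEdge d → G) (x : Fin d → ℤ) : G :=
  (((List.finRange d).reverse).map fun i =>
    lineR R (gammaPt (blockBase L (blockMap L x)) x i) i (x i - blockBase L (blockMap L x) i).toNat).prod

/-- [folklore] **the printed contours are axis-straight**: `AxisStraight L (gammaT L R) R` for every `R` and every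
`L ≥ 1` — so every hypothesis `hT : AxisStraight …` below and above is satisfiable by the contours of [2] (1.7),
for every background. -/
theorem axisStraight_gammaT {L : ℕ} (hL : 0 < L) (R : ZdEdge d → G) : AxisStraight L (gammaT L R) R := by
  intro y μ t ht
  have hblk : blockMap L (blockBase L y + Pi.single μ (t : ℤ)) = y := by
    refine blockMap_blockBase_add_of_lt L y _ (fun i => ?_) (fun i => ?_)
    · by_cases hi : i = μ
      · subst hi; simp only [Pi.single_eq_same]; omega
      · simp only [Pi.single_eq_of_ne hi]; exact le_rfl
    · by_cases hi : i = μ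
      · subst hi; simp only [Pi.single_eq_same]; omega
      · simp only [Pi.single_eq_of_ne hi]; exact_mod_cast hL
  unfold gammaT
  rw [hblk]
  rw [list_prod_map_eq_of_ne_one _ μ ?_ _ (List.nodup_reverse.2 (List.nodup_finRange d))]
  · rw [if_pos (List.mem_reverse.2 (List.mem_finRange μ))]
    have hpt : gammaPt (blockBase L y) (blockBase L y + Pi.single μ (t : ℤ)) μ = blockBase L y := by
      funext j
      by_cases hj : μ < j
      · simp only [gammaPt, if_pos hj, Pi.add_apply, Pi.single_eq_of_ne (ne_of_gt hj), add_zero]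
      · simp only [gammaPt, if_neg hj]
    rw [hpt]
    simp only [Pi.add_apply, Pi.single_eq_same, add_sub_cancel_left, Int.toNat_natCast]
  · intro i hi
    simp only [Pi.add_apply, Pi.single_eq_of_ne hi, add_zero, sub_self, Int.toNat_zero, lineR_zero]

end Gamma

/-! ## §8  The p. 267 paragraph, assembled; satisfiability by the printed contours -/

section Transcription

variable {G V : Type*} [Group G] [AddCommGroup V] [DistribMulAction G V] [Module ℝ V] [SMulCommClass G ℝ V]
  {L : ℕ} {T : (Fin d → ℤ) → G} {R : ZdEdge d → G}

/-- [cite: Balaban1987RG1, p.267] **THE `h` PARAGRAPH OF P. 267, TRANSCRIBED AND PROVED FOR THE TYPED MAIN TERM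
`LQ̃ := Q0 L T R` UNDER STRAIGHT AXIS CONTOURS**: (i) «The function hB is equal to 0 everywhere, except the set
{b₀(c) : c ∈ T⁽ᵏ⁺¹⁾}»; (ii) «the operator h satisfies the identity LQ̃h = I on T⁽ᵏ⁺¹⁾»; (iii) «Of course h is
uniquely defined by these conditions»; (iv) «in fact it is a very simple operator given by the equality
(hB)(b₀(c)) = h(c)B(c)»; (v) «where h(c) is a linear operator on the Lie algebra g, equal to an inverse of a
coefficient at the variable B′(b₀(c)) in (Q̃B′)(c), multiplied by L⁻¹».  Nothing of [B12] is assumed: `h` is the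
explicit `hOp b₀ hMain`, and (i)–(v) are kernel theorems about it. -/
theorem h_paragraph_p267 (hT : AxisStraight L T R) (hL : 0 < L) :
    (∀ B b, (¬ ∃ c, b0Z L c = b) → hOp (b0Z L) (hMain L R) B b = (0 : V)) ∧
    (∀ (B : ZdEdge d → V) c, Q0 L T R (hOp (b0Z L) (hMain L R) B) c = B c) ∧
    (∀ 𝒽 : (ZdEdge d → V) → ZdEdge d → V, CorridorSupported L 𝒽 → (∀ B c, Q0 L T R (𝒽 B) c = B c) →
      𝒽 = hOp (b0Z L) (hMain L R)) ∧
    (∀ (B : ZdEdge d → V) c, hOp (b0Z L) (hMain L R) B (b0Z L c) = hMain L R c (B c)) ∧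
    (∀ c (v : V), hMain L R c v = (L : ℝ)⁻¹ • (coefQt hT hL c).symm v) :=
  ⟨corridorSupported_hOp L _, Q0_hOp_hMain hT hL, fun _ hs hinv => eq_hOp_hMain hT hL hs hinv,
    fun B c => hOp_apply_b₀ (b0Z_injective hL) _ B c, hMain_eq_inv_coefQt hT hL⟩

/-- Satisfiability, non-degenerate: for EVERY background `R` on `ℤ²`, ratio `L = 3`, with the printed contours
(1.7) of [2] as `T`, the identity `LQ̃h = I` holds — the hypotheses of the paragraph theorem are met by genuine
(non-flat) data. -/
example (R : ZdEdge 2 → G) (B : ZdEdge 2 → V) (c : ZdEdge 2) :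
    Q0 3 (gammaT 3 R) R (hOp (b0Z 3) (hMain 3 R) B) c = B c :=
  Q0_hOp_hMain (axisStraight_gammaT (show 0 < 3 by norm_num) R) (show 0 < 3 by norm_num) B c

/-- … and uniqueness holds there too. -/
example (R : ZdEdge 2 → G) (𝒽 : (ZdEdge 2 → V) → ZdEdge 2 → V) (hs : CorridorSupported 3 𝒽)
    (hinv : ∀ B c, Q0 3 (gammaT 3 R) R (𝒽 B) c = B c) : 𝒽 = hOp (b0Z 3) (hMain 3 R) :=
  eq_hOp_hMain (axisStraight_gammaT (show 0 < 3 by norm_num) R) (show 0 < 3 by norm_num) hs hinv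

end Transcription

end Literature.MathematicalPhysics.QuantumFieldTheory.Balaban1983to89.B12HOperator267

end
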